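import Literature.Probability.Percolation.KozmaNitzanPreFKG
import Literature.Probability.Percolation.PercolationEvents
import HarnessLib

/-!
# `NoHeavyLowerTail` (stmt-CriticalPhenomena-4575) — the UNION EXCHANGE for a pair of terminals
# (Kozma–Nitzan's Theorem 1 for an arbitrary increasing cluster functional)

Prover `prim-gen-induct` (gen 7), `--supports stmt-CriticalPhenomena-4575`.  No definitions, no named facts,
no sorries; standard axioms.

Setting: bond percolation `μ = prodBernoulli w` on a finite vertex type, an observer `o`, two terminals
`a₁ ≠ a₂`, `U = {o ↔ a₁} ∪ {o ↔ a₂}` ("`o ↔ A`"), `D = {a₁ ↮ a₂}`, and an ARBITRARY upper family `𝒜` of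
edge sets, read on the open edge clusters `C_o`, `C_{a₁}`, `C_{a₂}` (van den Berg–Häggström–Kahn's `C_s`).
Kozma–Nitzan [KozmaNitzan2024, Thm. 1 (pp. 7–8)] prove, for the particular functional `𝒜 = {C ∋ b}`,
`P(0 ↔ b, 0 ↔ A) ≥ α P(0 ↔ A, a₁ ↔ b) + β P(0 ↔ A, a₂ ↔ b)` with `α : β = φ(1) : φ(2)`,
`φ(i) = P(0 ↔ aᵢ | a₁ ↮ a₂)` ("the coefficients in (5), which we find intriguing").  Their four
applications of BHK go through VERBATIM for any upper family:

* `UnionExchange.pair_clusterFunctional` — with `φᵢ = μ(D ∩ {o ↔ aᵢ})`,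
  `φ₁ · μ(U ∩ {C_{a₁} ∈ 𝒜}) + φ₂ · μ(U ∩ {C_{a₂} ∈ 𝒜}) ≤ (φ₁ + φ₂) · μ(U ∩ {C_o ∈ 𝒜})`;
* `UnionExchange.pair_clusterFunctional_min` — hence `min_i μ(U ∩ {C_{aᵢ} ∈ 𝒜}) ≤ μ(U ∩ {C_o ∈ 𝒜})`;
* `UnionExchange.pair_clusterDominance` — with Harris, the DOMINATION form
  `φ₁ · μ(U) μ{C_{a₁} ∈ 𝒜} + φ₂ · μ(U) μ{C_{a₂} ∈ 𝒜} ≤ (φ₁ + φ₂) · μ(U ∩ {C_o ∈ 𝒜})`: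
  the law of `C_o` given `o ↔ A` stochastically dominates the `φ`-mixture of the laws of `C_{a₁}`, `C_{a₂}`.

Why here (crux line, BLOBQUOTIENT.md §25–26 of the prover's notes): this is the `|W| = 2` union exchange
("UX / DOM′") of the anchor-gate programme in the case WITHOUT an avoided vertex; the avoided-vertex version
(law of `C_x` given `x ↔ W, x ↮ a`) is what closes RHLA for `|B| = 3`, and is recorded there as a conjecture
with its exact feasible weight interval.
-/

noncomputable section

open MeasureTheory Set
open Literature.Probability.LatticeModels (prodBernoulli)
open Literature.Probability.Percolation Literature.Probability.Percolation.KNPreFKG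

namespace Summit.CriticalPhenomena.PercolationContinuityZ3.Theorems

namespace UnionExchange

variable {V : Type*}

/-- Vertices in the same open component have the same open edge cluster. [folklore] -/
theorem openEdgeCluster_eq_of_reachable {ω : BondConfig V} {a c : V}
    (h : (openGraph ω).Reachable a c) : openEdgeCluster ω c = openEdgeCluster ω a := by
  ext e
  simp only [mem_openEdgeCluster_iff]
  exact ⟨fun ⟨he, hd, hr⟩ => ⟨he, hd, fun v hv => h.trans (hr v hv)⟩,
    fun ⟨he, hd, hr⟩ => ⟨he, hd, fun v hv => h.symm.trans (hr v hv)⟩⟩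

/-- An upper family read on an open edge cluster is an increasing event. [folklore] -/
theorem isUpperSet_setOf_openEdgeCluster_mem (s : V) {𝒜 : Set (Set (Sym2 V))} (h𝒜 : IsUpperSet 𝒜) :
    IsUpperSet {ω : BondConfig V | openEdgeCluster ω s ∈ 𝒜} :=
  fun _ _ hle h => h𝒜 (BHK2006.openEdgeCluster_mono hle s) h

variable [Fintype V]

/-- **Union exchange for a pair (Kozma–Nitzan's Theorem 1 for an arbitrary increasing cluster functional).**
For `a₁ ≠ a₂`, `U = {o ↔ a₁} ∪ {o ↔ a₂}`, `D = {a₁ ↮ a₂}`, `φᵢ = μ(D ∩ {o ↔ aᵢ})` and any upper family `𝒜`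
of edge sets:  `φ₁ · μ(U ∩ {C_{a₁} ∈ 𝒜}) + φ₂ · μ(U ∩ {C_{a₂} ∈ 𝒜}) ≤ (φ₁ + φ₂) · μ(U ∩ {C_o ∈ 𝒜})`.
Proof: KN pp. 7–8 with `{C ∋ b}` replaced by `𝒜` — on `{o ↔ a₁}` the clusters `C_o`, `C_{a₁}` coincide,
off it (inside `U`) one is in `D` with `C_o = C_{a₂}`; BHK Thm 1.3 / 1.4 given `D` four times. -/
theorem pair_clusterFunctional (w : Sym2 V → unitInterval) (o a₁ a₂ : V) (h12 : a₁ ≠ a₂)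
    {𝒜 : Set (Set (Sym2 V))} (h𝒜 : IsUpperSet 𝒜) :
    (prodBernoulli w).real ({ω : BondConfig V | ¬ (openGraph ω).Reachable a₁ a₂} ∩ openConn o a₁) *
        (prodBernoulli w).real ((openConn o a₁ ∪ openConn o a₂) ∩ {ω | openEdgeCluster ω a₁ ∈ 𝒜}) +
      (prodBernoulli w).real ({ω : BondConfig V | ¬ (openGraph ω).Reachable a₁ a₂} ∩ openConn o a₂) *
        (prodBernoulli w).real ((openConn o a₁ ∪ openConn o a₂) ∩ {ω | openEdgeCluster ω a₂ ∈ 𝒜}) ≤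
    ((prodBernoulli w).real ({ω : BondConfig V | ¬ (openGraph ω).Reachable a₁ a₂} ∩ openConn o a₁) +
        (prodBernoulli w).real ({ω : BondConfig V | ¬ (openGraph ω).Reachable a₁ a₂} ∩ openConn o a₂)) *
      (prodBernoulli w).real ((openConn o a₁ ∪ openConn o a₂) ∩ {ω | openEdgeCluster ω o ∈ 𝒜}) := by
  classical
  set μ := prodBernoulli w with hμ
  set O₁ : Set (BondConfig V) := openConn o a₁ with hO₁
  set O₂ : Set (BondConfig V) := openConn o a₂ with hO₂
  set A₀ : Set (BondConfig V) := {ω | openEdgeCluster ω o ∈ 𝒜} with hA₀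
  set A₁ : Set (BondConfig V) := {ω | openEdgeCluster ω a₁ ∈ 𝒜} with hA₁
  set A₂ : Set (BondConfig V) := {ω | openEdgeCluster ω a₂ ∈ 𝒜} with hA₂
  set D : Set (BondConfig V) := {ω | ¬ (openGraph ω).Reachable a₁ a₂} with hD
  set E : Set (BondConfig V) := (O₁ ∪ O₂) ∩ A₀ with hE
  set F₁ : Set (BondConfig V) := (O₁ ∪ O₂) ∩ A₁ with hF₁
  set F₂ : Set (BondConfig V) := (O₁ ∪ O₂) ∩ A₂ with hF₂
  have hsplit : ∀ A S : Set (BondConfig V), μ.real A = μ.real (A ∩ S) + μ.real (A ∩ Sᶜ) := by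
    intro A S
    rw [← measureReal_inter_add_sdiff (s := A) (MeasurableSet.of_discrete : MeasurableSet S), Set.sdiff_eq]
  -- cluster identities
  have hC1 : ∀ ω : BondConfig V, ω ∈ O₁ → openEdgeCluster ω a₁ = openEdgeCluster ω o :=
    fun ω h => openEdgeCluster_eq_of_reachable h
  have hC2 : ∀ ω : BondConfig V, ω ∈ O₂ → openEdgeCluster ω a₂ = openEdgeCluster ω o :=
    fun ω h => openEdgeCluster_eq_of_reachable h
  -- the "subtract the common event" identities
  have hE1 : E ∩ O₁ = F₁ ∩ O₁ := by
    ext ω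
    simp only [mem_inter_iff, mem_union, hE, hF₁, hA₀, hA₁, mem_setOf_eq]
    constructor
    · rintro ⟨⟨hU, hA⟩, h1⟩
      exact ⟨⟨hU, by rw [hC1 ω h1]; exact hA⟩, h1⟩
    · rintro ⟨⟨hU, hA⟩, h1⟩
      exact ⟨⟨hU, by rw [← hC1 ω h1]; exact hA⟩, h1⟩
  have hE1c : E ∩ O₁ᶜ = O₂ ∩ A₂ ∩ D := by
    ext ω
    simp only [mem_inter_iff, mem_union, mem_compl_iff, hE, hO₁, hO₂, hA₀, hA₂, hD, openConn,
      mem_setOf_eq]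
    constructor
    · rintro ⟨⟨h1 | h2, hA⟩, hn1⟩
      · exact absurd h1 hn1
      · refine ⟨⟨h2, ?_⟩, fun h => hn1 (h2.trans h.symm)⟩
        rw [openEdgeCluster_eq_of_reachable h2]; exact hA
    · rintro ⟨⟨h2, hA⟩, hn⟩
      refine ⟨⟨Or.inr h2, ?_⟩, fun h1 => hn (h1.symm.trans h2)⟩
      rw [← openEdgeCluster_eq_of_reachable h2]; exact hA
  have hF1c : F₁ ∩ O₁ᶜ = O₂ ∩ A₁ ∩ D := by
    ext ω
    simp only [mem_inter_iff, mem_union, mem_compl_iff, hF₁, hO₁, hO₂, hA₁, hD, openConn, mem_setOf_eq]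
    constructor
    · rintro ⟨⟨h1 | h2, hA⟩, hn1⟩
      · exact absurd h1 hn1
      · exact ⟨⟨h2, hA⟩, fun h => hn1 (h2.trans h.symm)⟩
    · rintro ⟨⟨h2, hA⟩, hn⟩
      exact ⟨⟨Or.inr h2, hA⟩, fun h1 => hn (h1.symm.trans h2)⟩
  have hE2 : E ∩ O₂ = F₂ ∩ O₂ := by
    ext ω
    simp only [mem_inter_iff, mem_union, hE, hF₂, hA₀, hA₂, mem_setOf_eq]
    constructor
    · rintro ⟨⟨hU, hA⟩, h2⟩
      exact ⟨⟨hU, by rw [hC2 ω h2]; exact hA⟩, h2⟩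
    · rintro ⟨⟨hU, hA⟩, h2⟩
      exact ⟨⟨hU, by rw [← hC2 ω h2]; exact hA⟩, h2⟩
  have hE2c : E ∩ O₂ᶜ = O₁ ∩ A₁ ∩ D := by
    ext ω
    simp only [mem_inter_iff, mem_union, mem_compl_iff, hE, hO₁, hO₂, hA₀, hA₁, hD, openConn,
      mem_setOf_eq]
    constructor
    · rintro ⟨⟨h1 | h2, hA⟩, hn2⟩
      · refine ⟨⟨h1, ?_⟩, fun h => hn2 (h1.trans h)⟩
        rw [openEdgeCluster_eq_of_reachable h1]; exact hA
      · exact absurd h2 hn2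
    · rintro ⟨⟨h1, hA⟩, hn⟩
      refine ⟨⟨Or.inl h1, ?_⟩, fun h2 => hn (h1.symm.trans h2)⟩
      rw [← openEdgeCluster_eq_of_reachable h1]; exact hA
  have hF2c : F₂ ∩ O₂ᶜ = O₁ ∩ A₂ ∩ D := by
    ext ω
    simp only [mem_inter_iff, mem_union, mem_compl_iff, hF₂, hO₁, hO₂, hA₂, hD, openConn, mem_setOf_eq]
    constructor
    · rintro ⟨⟨h1 | h2, hA⟩, hn2⟩
      · exact ⟨⟨h1, hA⟩, fun h => hn2 (h1.trans h)⟩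
      · exact absurd h2 hn2
    · rintro ⟨⟨h1, hA⟩, hn⟩
      exact ⟨⟨Or.inl h1, hA⟩, fun h2 => hn (h1.symm.trans h2)⟩
  have hdiff1 : μ.real E - μ.real F₁ = μ.real (O₂ ∩ A₂ ∩ D) - μ.real (O₂ ∩ A₁ ∩ D) := by
    rw [hsplit E O₁, hsplit F₁ O₁, hE1, hE1c, hF1c]
    ring
  have hdiff2 : μ.real E - μ.real F₂ = μ.real (O₁ ∩ A₁ ∩ D) - μ.real (O₁ ∩ A₂ ∩ D) := by
    rw [hsplit E O₂, hsplit F₂ O₂, hE2, hE2c, hF2c]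
    ring
  -- "Applying BHK 4 times", given `D = {a₁ ↮ a₂}`
  have hD1 : {ω : BondConfig V | ∀ x ∈ ({a₂} : Set V), ¬ (openGraph ω).Reachable a₁ x} = D := by
    ext ω
    simp [hD]
  have hD2 : {ω : BondConfig V | ∀ x ∈ ({a₁} : Set V), ¬ (openGraph ω).Reachable a₂ x} = D := by
    ext ω
    simp only [mem_setOf_eq, mem_singleton_iff, forall_eq, hD]
    exact not_congr ⟨SimpleGraph.Reachable.symm, SimpleGraph.Reachable.symm⟩
  have hD3 : {ω : BondConfig V | ¬ (openGraph ω).Reachable a₂ a₁} = D := by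
    ext ω
    simp only [mem_setOf_eq, hD]
    exact not_congr ⟨SimpleGraph.Reachable.symm, SimpleGraph.Reachable.symm⟩
  -- (i) `μ(D, o↔a₂) μ(D, C_{a₂}∈𝒜) ≤ μ(D) μ(D, o↔a₂, C_{a₂}∈𝒜)` (Thm. 1.3 in `C_{a₂}`)
  have h_i := bhk_one_upper_upper w a₂ ({a₁} : Set V) (by simpa using Ne.symm h12)
    (isUpperSet_connFamily a₂ o) h𝒜
  rw [hD2, ← openConn_eq_setOf_connFamily, openConn_symm a₂ o] at h_i
  -- (ii) `μ(D) μ(D, o↔a₂, C_{a₁}∈𝒜) ≤ μ(D, o↔a₂) μ(D, C_{a₁}∈𝒜)` (Thm. 1.4, `C_{a₂}` and `C_{a₁}`)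
  have h_ii := bhk_two_upper_upper w a₂ a₁ (Ne.symm h12) (isUpperSet_connFamily a₂ o) h𝒜
  rw [hD3, ← openConn_eq_setOf_connFamily, openConn_symm a₂ o] at h_ii
  -- (iii) `μ(D, o↔a₁) μ(D, C_{a₁}∈𝒜) ≤ μ(D) μ(D, o↔a₁, C_{a₁}∈𝒜)` (Thm. 1.3 in `C_{a₁}`)
  have h_iii := bhk_one_upper_upper w a₁ ({a₂} : Set V) (by simpa using h12)
    (isUpperSet_connFamily a₁ o) h𝒜
  rw [hD1, ← openConn_eq_setOf_connFamily, openConn_symm a₁ o] at h_iii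
  -- (iv) `μ(D) μ(D, o↔a₁, C_{a₂}∈𝒜) ≤ μ(D, o↔a₁) μ(D, C_{a₂}∈𝒜)` (Thm. 1.4, `C_{a₁}` and `C_{a₂}`)
  have h_iv := bhk_two_upper_upper w a₁ a₂ h12 (isUpperSet_connFamily a₁ o) h𝒜
  rw [← openConn_eq_setOf_connFamily, openConn_symm a₁ o] at h_iv
  -- normalise the intersections
  have e1 : D ∩ (O₂ ∩ A₂) = O₂ ∩ A₂ ∩ D := inter_comm _ _
  have e2 : D ∩ (O₂ ∩ A₁) = O₂ ∩ A₁ ∩ D := inter_comm _ _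
  have e3 : D ∩ (O₁ ∩ A₁) = O₁ ∩ A₁ ∩ D := inter_comm _ _
  have e4 : D ∩ (O₁ ∩ A₂) = O₁ ∩ A₂ ∩ D := inter_comm _ _
  simp only [← hD, ← hO₁, ← hO₂, ← hA₁, ← hA₂] at h_i h_ii h_iii h_iv
  rw [e1] at h_i
  rw [e2] at h_ii
  rw [e3] at h_iii
  rw [e4] at h_iv
  -- combine
  have hφ1 : 0 ≤ μ.real (D ∩ O₁) := measureReal_nonneg
  have hφ2 : 0 ≤ μ.real (D ∩ O₂) := measureReal_nonneg
  by_cases hD0 : μ.real D = 0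
  · have hz : ∀ A : Set (BondConfig V), μ.real (D ∩ A) = 0 := fun A =>
      le_antisymm ((measureReal_mono inter_subset_left).trans hD0.le) measureReal_nonneg
    rw [hz, hz]
    simp
  · have hDpos : 0 < μ.real D := lt_of_le_of_ne measureReal_nonneg (Ne.symm hD0)
    -- `μ(D) · [φ₁ (μE − μF₁) + φ₂ (μE − μF₂)] ≥ 0`
    have k1 := mul_le_mul_of_nonneg_left h_i hφ1
    have k2 := mul_le_mul_of_nonneg_left h_ii hφ1
    have k3 := mul_le_mul_of_nonneg_left h_iii hφ2
    have k4 := mul_le_mul_of_nonneg_left h_iv hφ2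
    have key : 0 ≤ μ.real D * (μ.real (D ∩ O₁) * (μ.real E - μ.real F₁) +
        μ.real (D ∩ O₂) * (μ.real E - μ.real F₂)) := by
      rw [hdiff1, hdiff2]
      nlinarith [k1, k2, k3, k4]
    have key' : 0 ≤ μ.real (D ∩ O₁) * (μ.real E - μ.real F₁) + μ.real (D ∩ O₂) * (μ.real E - μ.real F₂) :=
      nonneg_of_mul_nonneg_right (by simpa [mul_comm] using key) hDpos
    nlinarith [key']

/-- **Corollary ("pre-FKG" form for a functional): one of the two terminals serves.**  With the notation of
`pair_clusterFunctional`:  `min(μ(U ∩ {C_{a₁} ∈ 𝒜}), μ(U ∩ {C_{a₂} ∈ 𝒜})) ≤ μ(U ∩ {C_o ∈ 𝒜})`. -/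
theorem pair_clusterFunctional_min (w : Sym2 V → unitInterval) (o a₁ a₂ : V)
    {𝒜 : Set (Set (Sym2 V))} (h𝒜 : IsUpperSet 𝒜) :
    min ((prodBernoulli w).real ((openConn o a₁ ∪ openConn o a₂) ∩ {ω | openEdgeCluster ω a₁ ∈ 𝒜}))
        ((prodBernoulli w).real ((openConn o a₁ ∪ openConn o a₂) ∩ {ω | openEdgeCluster ω a₂ ∈ 𝒜})) ≤
      (prodBernoulli w).real ((openConn o a₁ ∪ openConn o a₂) ∩ {ω | openEdgeCluster ω o ∈ 𝒜}) := by
  classical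
  by_cases h12 : a₁ = a₂
  · subst h12
    rw [union_self]
    refine (min_le_left _ _).trans (le_of_eq ?_)
    congr 1
    ext ω
    simp only [mem_inter_iff, mem_setOf_eq, openConn, and_congr_right_iff]
    intro h
    rw [openEdgeCluster_eq_of_reachable h]
  set μ := prodBernoulli w with hμ
  have hmain := pair_clusterFunctional w o a₁ a₂ h12 h𝒜
  set p1 := μ.real ({ω : BondConfig V | ¬ (openGraph ω).Reachable a₁ a₂} ∩ openConn o a₁) with hp1
  set p2 := μ.real ({ω : BondConfig V | ¬ (openGraph ω).Reachable a₁ a₂} ∩ openConn o a₂) with hp2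
  set f1 := μ.real ((openConn o a₁ ∪ openConn o a₂) ∩ {ω | openEdgeCluster ω a₁ ∈ 𝒜}) with hf1
  set f2 := μ.real ((openConn o a₁ ∪ openConn o a₂) ∩ {ω | openEdgeCluster ω a₂ ∈ 𝒜}) with hf2
  set e := μ.real ((openConn o a₁ ∪ openConn o a₂) ∩ {ω | openEdgeCluster ω o ∈ 𝒜}) with he
  have hp1' : 0 ≤ p1 := measureReal_nonneg
  have hp2' : 0 ≤ p2 := measureReal_nonneg
  by_cases hsum : p1 + p2 = 0
  · -- then `μ(D ∩ {o ↔ a₂}) = 0`, and `μE − μF₁ = μ(O₂ ∩ A₂ ∩ D) − μ(O₂ ∩ A₁ ∩ D) ≥ −0`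
    have hp2z : p2 = 0 := by linarith
    refine (min_le_left _ _).trans ?_
    -- `F₁ ⊆ E ∪ (O₂ ∩ D)`-type bound: `μ(F₁) ≤ μ(F₁ ∩ O₁) + μ(F₁ ∖ O₁)`, `F₁ ∩ O₁ ⊆ E`, `F₁ ∖ O₁ ⊆ D ∩ O₂`
    have h1 : f1 ≤ μ.real (((openConn o a₁ ∪ openConn o a₂) ∩ {ω | openEdgeCluster ω a₁ ∈ 𝒜}) ∩ openConn o a₁) +
        μ.real (((openConn o a₁ ∪ openConn o a₂) ∩ {ω | openEdgeCluster ω a₁ ∈ 𝒜}) \ openConn o a₁) := by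
      rw [hf1, measureReal_inter_add_sdiff (MeasurableSet.of_discrete)]
    have h2 : μ.real (((openConn o a₁ ∪ openConn o a₂) ∩ {ω | openEdgeCluster ω a₁ ∈ 𝒜}) ∩ openConn o a₁) ≤ e := by
      refine measureReal_mono ?_
      rintro ω ⟨⟨hU, hA⟩, h1⟩
      refine ⟨hU, ?_⟩
      simp only [mem_setOf_eq] at hA ⊢
      rw [← openEdgeCluster_eq_of_reachable (show ω ∈ openConn o a₁ from h1)]; exact hA
    have h3 : μ.real (((openConn o a₁ ∪ openConn o a₂) ∩ {ω | openEdgeCluster ω a₁ ∈ 𝒜}) \ openConn o a₁) ≤ p2 := by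
      refine measureReal_mono ?_
      rintro ω ⟨⟨hU, _⟩, hn1⟩
      rcases hU with h1 | h2
      · exact absurd h1 hn1
      · exact ⟨fun h => hn1 (show ω ∈ openConn o a₁ from (h2.trans h.symm)), h2⟩
    linarith
  · have hpos : 0 < p1 + p2 := lt_of_le_of_ne (by linarith) (Ne.symm hsum)
    by_contra hlt
    rw [not_le] at hlt
    nlinarith [mul_nonneg hp1' (sub_nonneg.2 (min_le_left f1 f2)), mul_nonneg hp2' (sub_nonneg.2 (min_le_right f1 f2)),
      mul_pos hpos (sub_pos.2 hlt), hmain]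

/-- **Corollary (domination form).**  With Harris' inequality `μ(U ∩ {C_{aᵢ} ∈ 𝒜}) ≥ μ(U) μ{C_{aᵢ} ∈ 𝒜}`:
`φ₁ μ(U) μ{C_{a₁} ∈ 𝒜} + φ₂ μ(U) μ{C_{a₂} ∈ 𝒜} ≤ (φ₁ + φ₂) μ(U ∩ {C_o ∈ 𝒜})` — the law of `C_o` given
`o ↔ {a₁, a₂}` dominates the `(φ₁ : φ₂)`-mixture of the laws of `C_{a₁}` and `C_{a₂}` on every upper family. -/
theorem pair_clusterDominance (w : Sym2 V → unitInterval) (o a₁ a₂ : V) (h12 : a₁ ≠ a₂)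
    {𝒜 : Set (Set (Sym2 V))} (h𝒜 : IsUpperSet 𝒜) :
    ((prodBernoulli w).real ({ω : BondConfig V | ¬ (openGraph ω).Reachable a₁ a₂} ∩ openConn o a₁) *
        (prodBernoulli w).real {ω : BondConfig V | openEdgeCluster ω a₁ ∈ 𝒜} +
      (prodBernoulli w).real ({ω : BondConfig V | ¬ (openGraph ω).Reachable a₁ a₂} ∩ openConn o a₂) *
        (prodBernoulli w).real {ω : BondConfig V | openEdgeCluster ω a₂ ∈ 𝒜}) *
      (prodBernoulli w).real (openConn o a₁ ∪ openConn o a₂ : Set (BondConfig V)) ≤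
    ((prodBernoulli w).real ({ω : BondConfig V | ¬ (openGraph ω).Reachable a₁ a₂} ∩ openConn o a₁) +
        (prodBernoulli w).real ({ω : BondConfig V | ¬ (openGraph ω).Reachable a₁ a₂} ∩ openConn o a₂)) *
      (prodBernoulli w).real ((openConn o a₁ ∪ openConn o a₂) ∩ {ω | openEdgeCluster ω o ∈ 𝒜}) := by
  classical
  have hmain := pair_clusterFunctional w o a₁ a₂ h12 h𝒜
  have hU : IsUpperSet (openConn o a₁ ∪ openConn o a₂ : Set (BondConfig V)) :=
    (isUpperSet_openConn o a₁).union (isUpperSet_openConn o a₂)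
  have hH1 := Literature.Probability.LatticeModels.prodBernoulli_harris w hU
    (isUpperSet_setOf_openEdgeCluster_mem a₁ h𝒜) MeasurableSet.of_discrete MeasurableSet.of_discrete
  have hH2 := Literature.Probability.LatticeModels.prodBernoulli_harris w hU
    (isUpperSet_setOf_openEdgeCluster_mem a₂ h𝒜) MeasurableSet.of_discrete MeasurableSet.of_discrete
  have hφ1 : 0 ≤ (prodBernoulli w).real ({ω : BondConfig V | ¬ (openGraph ω).Reachable a₁ a₂} ∩ openConn o a₁) :=
    measureReal_nonneg
  have hφ2 : 0 ≤ (prodBernoulli w).real ({ω : BondConfig V | ¬ (openGraph ω).Reachable a₁ a₂} ∩ openConn o a₂) :=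
    measureReal_nonneg
  nlinarith [mul_le_mul_of_nonneg_left hH1 hφ1, mul_le_mul_of_nonneg_left hH2 hφ2, hmain]

end UnionExchange

end Summit.CriticalPhenomena.PercolationContinuityZ3.Theorems
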